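/-
Copyright (c) 2026. All rights reserved.
Released under Apache 2.0 license as described in the file LICENSE.
Authors: abc-iut cell, IUT REPAIR / RESCUE-H prover seat abc-iut-rp-d4 (gen 4).
-/
import Literature.IUT.LogVolume.UnitLogValuationProfileShell
import HarnessLib

/-!
# The VALUATION PROFILE of `log_p(𝒪_K^×)`, VI: COSETS on a properly-met sphere — `𝔪ᵗ ⊆ L + 𝔪^{t+1}` at an
# attained level `t = ν(s)`, and no coset of `𝔪^{t+1}` lies in `L`

PROOF-ONLY sequel (no `def`, no named fact) of `UnitLogValuationProfile{,Shell}.lean` (abc-iut cell, D-0079 RESCUE-H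
«local-height condition I06⋆»; R-H table of record `plan/rescue/R-H/I06STAR-COLUMNS.tsv`, col 42 «OPEN-element» cells).
Same setting: `K` a proper ultrametric normed `ℚ_p`-algebra, `e = absRamificationIdx p K`, `ϖ` a norm uniformizer,
`L = log_p(𝒪_K^×) = logUnits K`, `ν(s) = s·p^{a₀} − e·a₀` with `a₀` the STRICT turning point of `s`
(`s·pᵃ·(p−1) < e` for `a < a₀`, `e < s·p^{a₀}·(p−1)`).

Part II §6 (`sphere_meets_not_subset_logUnits`) says that the sphere `S_t = {‖z‖ = ‖ϖ‖ᵗ}` at `t = ν(s)`, `a₀ ≥ 1`,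
MEETS `L` without lying in it.  This file refines that to the level of COSETS of `𝔪^{t+1}` (the open balls of
radius `‖ϖ‖ᵗ` = the «residue classes» on `S_t`), which is what a statement about elements `p·q^{1−n}` with `q` of
PRESCRIBED NORM needs (sequel `UnitLogValuationProfileRealisable.lean`):

* §1 `norm_logSeries_sub_dominant_le` / `…_of_strictTurning` — the REMAINDER form of abc-iut-w5-d017's dominant-term
  read-out: `‖L(y) − T‖ ≤ ‖ϖ‖^{ν+1}` for the dominant term `T = −(1−y)^{p^{a₀}}/p^{a₀}` (`‖T‖ = ‖ϖ‖^ν`).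
* §2 `exists_norm_pow_prime_pow_sub_lt_one` — the residue field `𝒪/𝔪` is finite of characteristic `p`, so
  `x ↦ x^{pᵃ}` is onto: every unit `b` has a unit `c` with `‖c^{pᵃ} − b‖ < 1`.
* §3 **EVERY COSET IS MET**: for every `A` with `‖A‖ = ‖ϖ‖ᵗ`, `t = ν(s)`, there is `z ∈ L` with `‖z − A‖ < ‖A‖`
  (`exists_mem_logUnits_norm_sub_lt`: take `y = 1 − c·ϖˢ` with `c^{p^{a₀}} ≡ −A·p^{a₀}/ϖ^{s p^{a₀}}` mod `𝔪`; then
  `T − A = −(c^{p^{a₀}} − β)·ϖ^{s p^{a₀}}/p^{a₀}` is small and so is `L(y) − T`).  Equivalently `𝔪ᵗ ⊆ L + 𝔪^{t+1}`.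
* §4 **NO COSET IS CONTAINED** (`(p − 1) ∤ e`): for `r·(p−1) < e` and EVERY `A`, some `z` with `‖z − A‖ ≤ ‖ϖ‖ʳ` is
  NOT in `L` (`exists_norm_sub_le_not_mem_logUnits`: else `𝔪ʳ = (A + 𝔪ʳ) − A ⊆ L`, against the sharp inner radius
  `not_closedBall_zpow_subset_logUnits_of_mul_lt`); at `t = ν(s)`, `a₀ ≥ 1` this applies with `r = t + 1`
  (`succ_turningValue_mul_lt`, `exists_norm_sub_le_succ_not_mem_logUnits`).

Classical `p`-adic analysis (Neukirch ANT II (5.5); Fesenko–Vostokov I §5–6); nothing here is disputed mathematics;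
no IUT statement is asserted (`logUnits` is the cell's typing of [IUTchIV] Prop. 1.2's `log_p(R^×)`,
[claim: Mochizuki2012, status: disputed] for that locution only); no side taken on [IUTchIII] Cor. 3.12 or on any author.
References: [cite: NeukirchANT1999, Ch. II Prop. (5.5), (5.7)] [cite: Koblitz1984, Ch. IV §1–2].
-/

noncomputable section

open Metric Set IsLocalRing
open scoped Pointwise

namespace Literature.IUT.LogVolume

namespace ValuationProfile

open Literature.NumberTheory.GaloisRepresentations.Ultrametric RamificationCriterion

/-! ### §1. The remainder after the dominant term -/

section Remainder

variable (p : ℕ) [hp : Fact p.Prime]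
variable {K : Type*} [NontriviallyNormedField K] [instK : NormedAlgebra ℚ_[p] K] [IsUltrametricDist K]
  [ProperSpace K]

/-- **Remainder after a dominant term.**  If every term of the logarithmic series of the principal unit `y`
(`‖1 − y‖ = ‖ϖ‖ˢ`) other than the one of index `n₀ + 1` has exponent `≥ N₀ + 1`, then
`‖L(y) − (−(1−y)^{n₀+1}/(n₀+1))‖ ≤ ‖ϖ‖^{N₀+1}` (ultrametric bound on the convergent series with that term removed;
the read-out inside abc-iut-w5-d017's `norm_logSeries_eq_zpow_of_dominant`). [cite: NeukirchANT1999, Ch. II Prop. (5.5)] -/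
theorem norm_logSeries_sub_dominant_le {ϖ : Kˣ} (hϖ : IsUniformizer ϖ) {y : K} (hyP : IsPrincipal y)
    {s : ℤ} (hy : ‖1 - y‖ = ‖(ϖ : K)‖ ^ s) (n₀ : ℕ) {N₀ : ℤ}
    (h : ∀ n : ℕ, n ≠ n₀ →
      N₀ + 1 ≤ s * ((n + 1 : ℕ) : ℤ) - (absRamificationIdx p K : ℤ) * (padicValNat p (n + 1) : ℤ)) :
    ‖logSeries y - -((1 - y) ^ (n₀ + 1)) / (n₀ + 1 : K)‖ ≤ ‖(ϖ : K)‖ ^ (N₀ + 1) := by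
  classical
  have hρ0 : 0 < ‖(ϖ : K)‖ := norm_units_pos ϖ
  set f : ℕ → K := fun n ↦ -((1 - y) ^ (n + 1)) / (n + 1 : K) with hf
  have hsum : HasSum f (logSeries y) := hasSum_logSeries p hyP
  have hsum' : HasSum (fun n ↦ if n = n₀ then 0 else f n) (logSeries y - f n₀) :=
    hasSum_ite_sub_hasSum hsum n₀
  change ‖logSeries y - f n₀‖ ≤ _
  rw [← hsum'.tsum_eq]
  refine IsUltrametricDist.norm_tsum_le_of_forall_le_of_nonneg (zpow_pos hρ0 _).le fun n ↦ ?_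
  by_cases hn : n = n₀
  · rw [if_pos hn, norm_zero]; exact (zpow_pos hρ0 _).le
  · rw [if_neg hn, hf, norm_logTerm_eq_zpow p hϖ hy n]
    exact zpow_le_zpow_right_of_le_one₀ hρ0 hϖ.1.le (h n hn)

/-- **Remainder under a STRICT turning point.**  For a principal unit `y` with `‖1 − y‖ = ‖ϖ‖ˢ` and `a₀` the strict
turning point of `s`: `‖L(y) − (−(1−y)^{p^{a₀}}/p^{a₀})‖ ≤ ‖ϖ‖^{ν+1}`, `ν = s·p^{a₀} − e·a₀` — the term of index
`p^{a₀}` dominates with an integer gap (`exponent_min_strict`, `exists_exponent_le_index`).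
[cite: NeukirchANT1999, Ch. II Prop. (5.5)] -/
theorem norm_logSeries_sub_dominant_le_of_strictTurning {ϖ : Kˣ} (hϖ : IsUniformizer ϖ) {y : K}
    (hyP : IsPrincipal y) {s : ℤ} (hy : ‖1 - y‖ = ‖(ϖ : K)‖ ^ s) {a₀ : ℕ}
    (hlo : ∀ a < a₀, s * (p : ℤ) ^ a * ((p : ℤ) - 1) < absRamificationIdx p K)
    (hhi : (absRamificationIdx p K : ℤ) < s * (p : ℤ) ^ a₀ * ((p : ℤ) - 1)) :
    ‖logSeries y - -((1 - y) ^ (p ^ a₀)) / ((p : K) ^ a₀)‖ ≤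
      ‖(ϖ : K)‖ ^ (s * (p : ℤ) ^ a₀ - (absRamificationIdx p K : ℤ) * (a₀ : ℤ) + 1) := by
  classical
  have hρ0 : 0 < ‖(ϖ : K)‖ := norm_units_pos ϖ
  have hs1 : 1 ≤ s := by
    have h1 : ‖(ϖ : K)‖ ^ s < 1 := hy ▸ hyP
    have := (zpow_lt_one_iff_right_of_lt_one₀ hρ0 hϖ.1).mp h1
    omega
  set e : ℕ := absRamificationIdx p K with he_def
  have hP : (2 : ℤ) ≤ (p : ℤ) := by exact_mod_cast hp.out.two_le
  have hstrict : ∀ a : ℕ, a ≠ a₀ →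
      s * (p : ℤ) ^ a₀ - e * (a₀ : ℤ) + 1 ≤ s * (p : ℤ) ^ a - e * (a : ℤ) :=
    fun a ha ↦ exponent_min_strict (a₀ := a₀) hs1 hP hlo hhi ha
  obtain ⟨n₀, hn₀1⟩ : ∃ n₀ : ℕ, n₀ + 1 = p ^ a₀ :=
    ⟨p ^ a₀ - 1, Nat.sub_add_cancel (Nat.one_le_pow _ _ hp.out.pos)⟩
  have hdom : ∀ n : ℕ, n ≠ n₀ → s * (p : ℤ) ^ a₀ - e * (a₀ : ℤ) + 1
      ≤ s * ((n + 1 : ℕ) : ℤ) - (e : ℤ) * (padicValNat p (n + 1) : ℤ) := by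
    intro n hn
    obtain ⟨a, ha, ha'⟩ := exists_exponent_le_index (p := p) hs1 e (Nat.succ_ne_zero n)
    by_cases haa : a = a₀
    · have hne : n + 1 ≠ p ^ a := by
        rw [haa, ← hn₀1]; intro h; exact hn (by omega)
      have := ha' hne
      rw [haa] at this
      exact this
    · exact (hstrict a haa).trans ha
  have hmain := norm_logSeries_sub_dominant_le p hϖ hyP hy n₀ hdom
  have hcast : (n₀ : K) + 1 = (p : K) ^ a₀ := by
    have := congrArg (Nat.cast : ℕ → K) hn₀1
    push_cast at this
    exact this
  rw [hn₀1, hcast] at hmain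
  exact hmain

end Remainder

/-! ### §2. `x ↦ x^{pᵃ}` is onto modulo `𝔪` (finite residue field of characteristic `p`) -/

section Frobenius

open scoped NormedField

variable (p : ℕ) [hp : Fact p.Prime]
variable {K : Type*} [NontriviallyNormedField K] [instK : NormedAlgebra ℚ_[p] K] [IsUltrametricDist K]
  [ProperSpace K]

/-- **Every unit is a `pᵃ`-th power modulo `𝔪`.**  For `‖b‖ = 1` there is `c` with `‖c‖ = 1` and
`‖c^{pᵃ} − b‖ < 1`: the residue field `𝒪/𝔪` is finite (`finite_residueField`) of characteristic `p`
(`charP_residueField`), so the iterated Frobenius `x ↦ x^{pᵃ}`, an injective ring endomorphism of a finite field, is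
onto; lift a preimage of the class of `b`. [cite: NeukirchANT1999, Ch. II Prop. (5.7)] -/
theorem exists_norm_pow_prime_pow_sub_lt_one (a : ℕ) {b : K} (hb : ‖b‖ = 1) :
    ∃ c : K, ‖c‖ = 1 ∧ ‖c ^ (p ^ a) - b‖ < 1 := by
  haveI := charP_residueField p K
  haveI : Finite (ResidueField (Valued.integer K)) := finite_residueField
  haveI : ExpChar (ResidueField (Valued.integer K)) p := ExpChar.prime hp.out
  have hsurj : Function.Surjective (iterateFrobenius (ResidueField (Valued.integer K)) p a) :=
    Finite.surjective_of_injective (iterateFrobenius (ResidueField (Valued.integer K)) p a).injective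
  let b' : Valued.integer K := ⟨b, Valued.integer.mem_iff.mpr hb.le⟩
  obtain ⟨γ, hγ⟩ := hsurj (residue (Valued.integer K) b')
  obtain ⟨c', hc'⟩ := Ideal.Quotient.mk_surjective (I := maximalIdeal (Valued.integer K)) γ
  have hc'γ : residue (Valued.integer K) c' = γ := hc'
  have hbres : residue (Valued.integer K) b' ≠ 0 := by
    intro h0
    rw [residue_eq_zero_iff, mem_maximalIdeal_iff_norm_lt_one] at h0
    exact absurd hb (ne_of_lt h0)
  have hγ0 : γ ≠ 0 := by
    intro h0
    rw [h0, iterateFrobenius_def, zero_pow (pow_ne_zero a hp.out.ne_zero)] at hγ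
    exact hbres hγ.symm
  refine ⟨(c' : K), ?_, ?_⟩
  · have hle : ‖(c' : K)‖ ≤ 1 := Valued.integer.mem_iff.mp c'.2
    have hnot : ¬ ‖(c' : K)‖ < 1 := by
      intro hlt
      apply hγ0
      rw [← hc'γ, residue_eq_zero_iff, mem_maximalIdeal_iff_norm_lt_one]
      exact hlt
    exact le_antisymm hle (not_lt.mp hnot)
  · have hmem : c' ^ (p ^ a) - b' ∈ maximalIdeal (Valued.integer K) := by
      rw [← residue_eq_zero_iff, map_sub, map_pow, hc'γ, ← iterateFrobenius_def, hγ, sub_self]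
    have hlt := (mem_maximalIdeal_iff_norm_lt_one _).mp hmem
    exact hlt

end Frobenius

/-! ### §3. EVERY COSET of `𝔪^{t+1}` on the sphere `S_t`, `t = ν(s)`, MEETS `log_p(𝒪_K^×)` -/

section Cosets

variable (p : ℕ) [hp : Fact p.Prime]
variable {K : Type*} [NontriviallyNormedField K] [instK : NormedAlgebra ℚ_[p] K] [IsUltrametricDist K]
  [ProperSpace K]

/-- **EVERY RESIDUE CLASS AT AN ATTAINED LEVEL IS MET: `𝔪ᵗ ⊆ log_p(𝒪_K^×) + 𝔪^{t+1}` for `t = ν(s)`.**  Let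
`s ≥ 1` with STRICT turning point `a₀` (any `a₀ ≥ 0`), `t = s·p^{a₀} − e·a₀`.  For EVERY `A` with `‖A‖ = ‖ϖ‖ᵗ`
there is `z ∈ log_p(𝒪_K^×)` with `‖z − A‖ < ‖A‖`: with `β := −A·p^{a₀}/ϖ^{s·p^{a₀}}` (a unit) choose a unit `c` with
`c^{p^{a₀}} ≡ β` mod `𝔪` (§2) and `y := 1 − c·ϖˢ`; the dominant term of `L(y)` is `T = −c^{p^{a₀}}ϖ^{s p^{a₀}}/p^{a₀}`,
`T − A = −(c^{p^{a₀}} − β)·ϖ^{s p^{a₀}}/p^{a₀}` has norm `< ‖ϖ‖ᵗ`, and `‖L(y) − T‖ ≤ ‖ϖ‖^{t+1}` (§1).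
[cite: NeukirchANT1999, Ch. II Prop. (5.5), (5.7)] -/
theorem exists_mem_logUnits_norm_sub_lt {ϖ : Kˣ} (hϖ : IsUniformizer ϖ) {s : ℕ} (hs : 1 ≤ s) {a₀ : ℕ}
    (hlo : ∀ a < a₀, (s : ℤ) * (p : ℤ) ^ a * ((p : ℤ) - 1) < absRamificationIdx p K)
    (hhi : (absRamificationIdx p K : ℤ) < (s : ℤ) * (p : ℤ) ^ a₀ * ((p : ℤ) - 1)) {A : K}
    (hA : ‖A‖ = ‖(ϖ : K)‖ ^ ((s : ℤ) * (p : ℤ) ^ a₀ - (absRamificationIdx p K : ℤ) * (a₀ : ℤ))) :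
    ∃ z ∈ logUnits K, ‖z - A‖ < ‖A‖ := by
  have hρ0 : 0 < ‖(ϖ : K)‖ := norm_units_pos ϖ
  have hρ : ‖(ϖ : K)‖ ≠ 0 := hρ0.ne'
  have hw0 : (ϖ : K) ≠ 0 := ϖ.ne_zero
  have hP0 : (p : K) ≠ 0 := prime_ne_zero p K
  set e : ℕ := absRamificationIdx p K with he_def
  set N : ℕ := p ^ a₀ with hN
  have hNpos : 0 < N := pow_pos hp.out.pos a₀
  -- norms of the building blocks
  have hnP : ‖(p : K) ^ a₀‖ = ‖(ϖ : K)‖ ^ ((e : ℤ) * (a₀ : ℤ)) := by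
    rw [norm_pow, norm_prime_eq_norm_pow p K hϖ, ← pow_mul, ← zpow_natCast]
    push_cast
    rfl
  have hnW : ‖(ϖ : K) ^ (s * N)‖ = ‖(ϖ : K)‖ ^ ((s : ℤ) * (p : ℤ) ^ a₀) := by
    rw [norm_pow, ← zpow_natCast, hN]
    push_cast
    rfl
  have hquot : ‖(ϖ : K) ^ (s * N) / (p : K) ^ a₀‖ =
      ‖(ϖ : K)‖ ^ ((s : ℤ) * (p : ℤ) ^ a₀ - (e : ℤ) * (a₀ : ℤ)) := by
    rw [norm_div, hnW, hnP, ← zpow_sub₀ hρ]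
  -- the target residue `β` and the unit `c`
  set β : K := -(A * (p : K) ^ a₀) / (ϖ : K) ^ (s * N) with hβ
  have hβ1 : ‖β‖ = 1 := by
    rw [hβ, norm_div, norm_neg, norm_mul, hA, hnP, hnW, ← zpow_add₀ hρ, div_eq_one_iff_eq (zpow_ne_zero _ hρ)]
    congr 1
    ring
  obtain ⟨c, hc1, hcβ⟩ := exists_norm_pow_prime_pow_sub_lt_one p a₀ hβ1
  -- the principal unit `y = 1 − c ϖˢ` and its logarithm
  set y : K := 1 - c * (ϖ : K) ^ s with hy_def
  have hx : 1 - y = c * (ϖ : K) ^ s := by rw [hy_def]; ring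
  have hy : ‖1 - y‖ = ‖(ϖ : K)‖ ^ (s : ℤ) := by
    rw [hx, norm_mul, hc1, one_mul, norm_pow, zpow_natCast]
  have hyP : IsPrincipal y := by
    change ‖1 - y‖ < 1
    rw [hy, zpow_natCast]
    exact pow_lt_one₀ (norm_nonneg _) hϖ.1 (by omega)
  have hy1 : ‖y‖ = 1 := hyP.norm_eq_one
  refine ⟨logSeries y, ?_, ?_⟩
  · rw [← unitLog_of_isPrincipal (p := p) hyP]
    exact unitLog_mem_logUnits hy1
  -- dominant term `T` and the two estimates
  set T : K := -((1 - y) ^ (p ^ a₀)) / ((p : K) ^ a₀) with hT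
  have hrem := norm_logSeries_sub_dominant_le_of_strictTurning p hϖ hyP hy hlo hhi
  have hTA : T - A = -(c ^ (p ^ a₀) - β) * ((ϖ : K) ^ (s * N) / (p : K) ^ a₀) := by
    rw [hT, hx, hβ, mul_pow, ← pow_mul, hN]
    field_simp
    ring
  have hTA' : ‖T - A‖ < ‖A‖ := by
    rw [hTA, norm_mul, norm_neg, hquot, hA]
    calc ‖c ^ (p ^ a₀) - β‖ * ‖(ϖ : K)‖ ^ ((s : ℤ) * (p : ℤ) ^ a₀ - (e : ℤ) * (a₀ : ℤ))
        < 1 * ‖(ϖ : K)‖ ^ ((s : ℤ) * (p : ℤ) ^ a₀ - (e : ℤ) * (a₀ : ℤ)) :=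
          mul_lt_mul_of_pos_right hcβ (zpow_pos hρ0 _)
      _ = _ := one_mul _
  have hrem' : ‖logSeries y - T‖ < ‖A‖ := by
    rw [hA]
    exact hrem.trans_lt (zpow_lt_zpow_right_of_lt_one₀ hρ0 hϖ.1 (lt_add_one _))
  calc ‖logSeries y - A‖ = ‖(logSeries y - T) + (T - A)‖ := by rw [sub_add_sub_cancel]
    _ ≤ max ‖logSeries y - T‖ ‖T - A‖ := IsUltrametricDist.norm_add_le_max _ _
    _ < ‖A‖ := max_lt hrem' hTA'

/-- Set form of §3: **`𝔪ᵗ ⊆ log_p(𝒪_K^×) + 𝔪^{t+1}`** at `t = ν(s)` — every `A` with `‖A‖ ≤ ‖ϖ‖ᵗ` is `z + w` with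
`z ∈ L` and `‖w‖ ≤ ‖ϖ‖^{t+1}` (for `‖A‖ < ‖ϖ‖ᵗ` take `z = 0`). [cite: NeukirchANT1999, Ch. II Prop. (5.5), (5.7)] -/
theorem exists_mem_logUnits_norm_sub_le_succ {ϖ : Kˣ} (hϖ : IsUniformizer ϖ) {s : ℕ} (hs : 1 ≤ s) {a₀ : ℕ}
    (hlo : ∀ a < a₀, (s : ℤ) * (p : ℤ) ^ a * ((p : ℤ) - 1) < absRamificationIdx p K)
    (hhi : (absRamificationIdx p K : ℤ) < (s : ℤ) * (p : ℤ) ^ a₀ * ((p : ℤ) - 1)) {A : K}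
    (hA : ‖A‖ ≤ ‖(ϖ : K)‖ ^ ((s : ℤ) * (p : ℤ) ^ a₀ - (absRamificationIdx p K : ℤ) * (a₀ : ℤ))) :
    ∃ z ∈ logUnits K,
      ‖A - z‖ ≤ ‖(ϖ : K)‖ ^ ((s : ℤ) * (p : ℤ) ^ a₀ - (absRamificationIdx p K : ℤ) * (a₀ : ℤ) + 1) := by
  have hρ0 : 0 < ‖(ϖ : K)‖ := norm_units_pos ϖ
  rcases hA.lt_or_eq with hlt | heq
  · refine ⟨0, zero_mem_logUnits (p := p), ?_⟩
    rw [sub_zero]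
    -- `‖A‖ < ‖ϖ‖ᵗ` forces `‖A‖ ≤ ‖ϖ‖^{t+1}` (discrete value group)
    rcases eq_or_ne A 0 with h0 | h0
    · rw [h0, norm_zero]; exact (zpow_pos hρ0 _).le
    · obtain ⟨k, hk⟩ := hϖ.2 (Units.mk0 A h0)
      rw [Units.val_mk0] at hk
      rw [hk] at hlt ⊢
      have := (zpow_lt_zpow_iff_right_of_lt_one₀ hρ0 hϖ.1).mp hlt
      exact zpow_le_zpow_right_of_le_one₀ hρ0 hϖ.1.le (by omega)
  · obtain ⟨z, hz, hzA⟩ := exists_mem_logUnits_norm_sub_lt p hϖ hs hlo hhi heq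
    refine ⟨z, hz, ?_⟩
    rw [heq] at hzA
    rw [norm_sub_rev]
    rcases eq_or_ne (z - A) 0 with h0 | h0
    · rw [h0, norm_zero]; exact (zpow_pos hρ0 _).le
    · obtain ⟨k, hk⟩ := hϖ.2 (Units.mk0 (z - A) h0)
      rw [Units.val_mk0] at hk
      rw [hk] at hzA ⊢
      have := (zpow_lt_zpow_iff_right_of_lt_one₀ hρ0 hϖ.1).mp hzA
      exact zpow_le_zpow_right_of_le_one₀ hρ0 hϖ.1.le (by omega)

/-! ### §4. NO COSET of `𝔪ʳ`, `r·(p−1) < e`, is contained in `log_p(𝒪_K^×)` (`(p − 1) ∤ e`) -/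

/-- **No coset of a too-large ball lies in `log_p(𝒪_K^×)`** (`(p − 1) ∤ e`): if `r·(p−1) < e` then for EVERY
`A ∈ K` some `z` with `‖z − A‖ ≤ ‖ϖ‖ʳ` is NOT a log-unit — otherwise `A ∈ L` and `A + 𝔪ʳ ⊆ L` give `𝔪ʳ ⊆ L`
(`L` is a group), contradicting the sharp inner radius (`not_closedBall_zpow_subset_logUnits_of_mul_lt`).
[cite: NeukirchANT1999, Ch. II Prop. (5.5)] -/
theorem exists_norm_sub_le_not_mem_logUnits (hnd : ¬ (p - 1) ∣ absRamificationIdx p K) {ϖ : Kˣ}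
    (hϖ : IsUniformizer ϖ) {r : ℤ} (hr : r * ((p : ℤ) - 1) < absRamificationIdx p K) (A : K) :
    ∃ z : K, ‖z - A‖ ≤ ‖(ϖ : K)‖ ^ r ∧ z ∉ logUnits K := by
  by_contra hnone
  push Not at hnone
  apply not_closedBall_zpow_subset_logUnits_of_mul_lt p hnd hϖ hr
  intro y hy
  rw [mem_closedBall, dist_zero_right] at hy
  have hA : A ∈ logUnits K :=
    hnone A (by rw [sub_self, norm_zero]; exact (zpow_pos (norm_units_pos ϖ) _).le)
  have hAy : A + y ∈ logUnits K := hnone (A + y) (by rwa [add_sub_cancel_left])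
  have hsub : (A + y) - A ∈ (logUnitsAddSubgroup p K : Set K) := (logUnitsAddSubgroup p K).sub_mem hAy hA
  simpa using hsub

/-- At an attained level with `a₀ ≥ 1`: **`(ν(s) + 1)·(p − 1) < e`** (indeed `ν(s) ≤ s − a₀ ≤ s − 1`,
`turningValue_add_le`, and `s·(p−1) < e` is the turning inequality at `a = 0 < a₀`).
[cite: NeukirchANT1999, Ch. II Prop. (5.5)] -/
theorem succ_turningValue_mul_lt {s : ℕ} {a₀ : ℕ} (ha₀ : a₀ ≠ 0)
    (hlo : ∀ a < a₀, (s : ℤ) * (p : ℤ) ^ a * ((p : ℤ) - 1) < absRamificationIdx p K) :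
    ((s : ℤ) * (p : ℤ) ^ a₀ - (absRamificationIdx p K : ℤ) * (a₀ : ℤ) + 1) * ((p : ℤ) - 1) <
      absRamificationIdx p K := by
  have hle := turningValue_add_le p (a₀ := a₀) hlo
  have h0 := hlo 0 (Nat.pos_of_ne_zero ha₀)
  simp only [pow_zero, mul_one] at h0
  have ha1 : (1 : ℤ) ≤ (a₀ : ℤ) := by exact_mod_cast Nat.one_le_iff_ne_zero.mpr ha₀
  have hp1' : (0 : ℤ) < (p : ℤ) - 1 := by have := hp.out.two_le; omega
  calc ((s : ℤ) * (p : ℤ) ^ a₀ - (absRamificationIdx p K : ℤ) * (a₀ : ℤ) + 1) * ((p : ℤ) - 1)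
      ≤ (s : ℤ) * ((p : ℤ) - 1) := mul_le_mul_of_nonneg_right (by linarith) hp1'.le
    _ < absRamificationIdx p K := h0

/-- **NO COSET at a properly-met level is contained** (`(p − 1) ∤ e`, `t = ν(s)`, `a₀ ≥ 1`): for EVERY `A ∈ K`
some `z` with `‖z − A‖ ≤ ‖ϖ‖^{t+1}` — in particular with `‖z‖ = ‖A‖` when `‖A‖ = ‖ϖ‖ᵗ` — is NOT in `log_p(𝒪_K^×)`.
With §3: on the sphere `S_t` EVERY residue class contains log-units AND non-log-units.
[cite: NeukirchANT1999, Ch. II Prop. (5.5)] -/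
theorem exists_norm_sub_le_succ_not_mem_logUnits (hnd : ¬ (p - 1) ∣ absRamificationIdx p K) {ϖ : Kˣ}
    (hϖ : IsUniformizer ϖ) {s : ℕ} {a₀ : ℕ} (ha₀ : a₀ ≠ 0)
    (hlo : ∀ a < a₀, (s : ℤ) * (p : ℤ) ^ a * ((p : ℤ) - 1) < absRamificationIdx p K) (A : K) :
    ∃ z : K, ‖z - A‖ ≤ ‖(ϖ : K)‖ ^ ((s : ℤ) * (p : ℤ) ^ a₀ - (absRamificationIdx p K : ℤ) * (a₀ : ℤ) + 1) ∧
      z ∉ logUnits K :=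
  exists_norm_sub_le_not_mem_logUnits p hnd hϖ (succ_turningValue_mul_lt p ha₀ hlo) A

/-- **EVERY RESIDUE CLASS ON A PROPERLY-MET SPHERE SPLITS** (`(p − 1) ∤ e`, `t = ν(s)`, `s ≥ 1`, `a₀ ≥ 1` strict):
for every `A` with `‖A‖ = ‖ϖ‖ᵗ` there are `z₁ ∈ log_p(𝒪_K^×)` and `z₂ ∉ log_p(𝒪_K^×)` with `‖zᵢ − A‖ < ‖A‖`
(hence `‖zᵢ‖ = ‖A‖`).  So on `S_t` NO datum that is constant on residue classes — let alone the norm — decides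
membership in `log_p(𝒪_K^×)`. [cite: NeukirchANT1999, Ch. II Prop. (5.5), (5.7)] -/
theorem coset_splits (hnd : ¬ (p - 1) ∣ absRamificationIdx p K) {ϖ : Kˣ} (hϖ : IsUniformizer ϖ) {s : ℕ}
    (hs : 1 ≤ s) {a₀ : ℕ} (ha₀ : a₀ ≠ 0)
    (hlo : ∀ a < a₀, (s : ℤ) * (p : ℤ) ^ a * ((p : ℤ) - 1) < absRamificationIdx p K)
    (hhi : (absRamificationIdx p K : ℤ) < (s : ℤ) * (p : ℤ) ^ a₀ * ((p : ℤ) - 1)) {A : K}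
    (hA : ‖A‖ = ‖(ϖ : K)‖ ^ ((s : ℤ) * (p : ℤ) ^ a₀ - (absRamificationIdx p K : ℤ) * (a₀ : ℤ))) :
    (∃ z ∈ logUnits K, ‖z - A‖ < ‖A‖) ∧ (∃ z ∉ logUnits K, ‖z - A‖ < ‖A‖) := by
  refine ⟨exists_mem_logUnits_norm_sub_lt p hϖ hs hlo hhi hA, ?_⟩
  obtain ⟨z, hz, hzL⟩ := exists_norm_sub_le_succ_not_mem_logUnits p hnd hϖ ha₀ hlo A
  refine ⟨z, hzL, hz.trans_lt ?_⟩
  rw [hA]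
  exact zpow_lt_zpow_right_of_lt_one₀ (norm_units_pos ϖ) hϖ.1 (lt_add_one _)

end Cosets

end ValuationProfile

end Literature.IUT.LogVolume

end
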